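import Literature.IUT.HodgeTheaters.PiAvatarLabelAutPM
import HarnessLib

/-!
# KIT-INSTANCE-SPEC P5-binding: the GLOBAL label slots on ALL isomorphs `†𝒟^{⊚±}` of `𝒟^{⊚±}` — `GLab`, `gLabMap`,
# `toFlStar`, and the kit laws `autCsp_le` (every `G`) / `gLab_range` / `toFlStar_surjective` in the literal shape of
# `PMBaseKit`, by TRANSPORT along chosen markings `†𝒟^{⊚±} ⥲ 𝒟^{⊚±}` ([IUTchI] Def 6.1 (v)(vi); defs — post-freeze additive
# D13, not a cone member)

S. Mochizuki, *Inter-universal Teichmüller theory I*, kurims manuscript (May 2020), Def 6.1 (vi) p. 159 («Let `†𝒟^{⊚±}` be any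
category isomorphic to `𝒟^{⊚±}`. Then … it makes sense to speak of the set of cusps of `†𝒟^{⊚±}`, as well as the set of ±-label
classes of cusps `LabCusp^±(†𝒟^{⊚±})` — which, in this case, may be identified with the set of cusps of `†𝒟^{⊚±}`»), Def 6.1 (v)
p. 158 («natural surjective homomorphism `Aut(𝒟^{⊚±}) ↠ 𝔽_l^⋇`», «`Aut_csp(𝒟^{⊚±}) ⊆ Aut_±(𝒟^{⊚±})`», «`Aut_±(𝒟^{⊚±})/Aut_csp(𝒟^{⊚±})
⥲ 𝔽_l^{⋊±}`») ([IUTchI] Def 6.1 (vi) p.159) [claim: Mochizuki2012, status: disputed] (D-0012 claim key, series status DISPUTED —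
definitions and kernel theorems over abc-iut-L5-t2's REAL `InitialThetaData`, abc-iut-L5-t1's `CuspGalois`, under the binders
`hS : D.CuspClassesNormaliserStable` (G-L5t4g3-3) and `[(D.PiXund.subgroupOf D.PiXK).Normal]`; nothing of the series is asserted, no
side is taken on [IUTchIII] Cor. 3.12).

## What is built (for `D : InitialThetaData`; `D.Glob` = the full subcategory of the Π-avatar ambient on the isomorphs of
`𝒟^{⊚±} = ℬ(Π_{X̲_K})⁰`, `PiAvatarBinding` p423760)
* `gMarking G : G ≅ D.gModel` — a CHOSEN isomorphism to the model (the identity at the model, `gMarking_gModel`); print transports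
  every global structure along «an isomorphism `𝒟^{⊚±} ⥲ †𝒟^{⊚±}`» (Def 6.1 (v)(vi); kit docstring of `gLabT`);
* `toModelAut f : Aut (D.gModelObj)` for `f : G ≅ H` — the automorphism `μ_G⁻¹ ≫ f ≫ μ_H` of `𝒟^{⊚±}` read in the ambient
  (`_hom`, `_refl`, `_trans`, `_isoMk`); `toModelAutHom G : Aut G →* Aut (D.gModelObj)` (an isomorphism of groups: `_bijective`,
  with section `ofModelAut`);
* kit slot **`GLabOf G := Cusp(X̲_K)`** (the cusps, Def 6.1 (vi)) and **`gLabIso f := gLabAutModel (toModelAut f)`** with the kit laws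
  `gLabIso_refl`, `gLabIso_trans` (functoriality);
* kit slot **`toFlStarOf G : Aut G →* 𝔽_l^⋇`** `:= toFlStarGlobal ∘ toModelAutHom G`, `toFlStarOf_gModel_isoMk`;
* kit laws in the literal shape of `PMBaseKit`: **`autCsp_le_of`** (every `G`: `gLabIso α = Equiv.refl → toFlStarOf G α = 1`),
  **`gLab_range_of`** (`σ ∈ gLabT.autPM ↔ ∃ α : Aut gModel, toFlStarOf gModel α = 1 ∧ gLabIso α = σ`), and
  **`toFlStarOf_surjective_of`** (surjectivity on every `G` from surjectivity of `toFlStarGlobal` — the latter is abc-iut-L5-t8's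
  `toFlStarGlobal_surjective_of_torsionMonodromy`, consumed by name at assembly).
No instance, no notation; typed ≠ proved elsewhere.
-/

noncomputable section

namespace Literature.IUT.HodgeTheaters

open CategoryTheory

universe u v w

section GlobTransport

variable {F : Type u} {K : Type v} {Fbar : Type w} [Field F] [NumberField F] [Field K] [NumberField K]
  [Algebra F K] [Field Fbar] [Algebra F Fbar] [Algebra K Fbar]
  {E : WeierstrassCurve F} [E.IsElliptic] {l : ℕ} {Pb : BadPlacePredicates K}
  (D : InitialThetaData F K Fbar E l Pb)

namespace InitialThetaData

/-! ### Markings `†𝒟^{⊚±} ⥲ 𝒟^{⊚±}` and the reduction of isomorphisms to automorphisms of the model -/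

open Classical in
/-- **A chosen marking `μ_G : †𝒟^{⊚±} ⥲ 𝒟^{⊚±}`** of an isomorph (Def 6.1 (v)/(vi): structures on `†𝒟^{⊚±}` are obtained «by
transport along an isomorphism `𝒟^{⊚±} ⥲ †𝒟^{⊚±}`, well-defined exactly up to `Aut_±`»); the identity at the model itself.
([IUTchI] Def 6.1 (vi) p.159) [claim: Mochizuki2012, status: disputed] -/
def gMarking (G : D.Glob) : G ≅ D.gModel :=
  if h : G = D.gModel then eqToIso h else (D.gIso G).some

/-- The marking of the model is the identity. ([IUTchI] Def 6.1 (vi) p.159) [claim: Mochizuki2012, status: disputed] -/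
theorem gMarking_gModel : D.gMarking D.gModel = Iso.refl _ := by
  rw [gMarking, dif_pos rfl, eqToIso_refl]

/-- **`μ_G⁻¹ ≫ f ≫ μ_H` read in the ambient**: the automorphism of `𝒟^{⊚±} = ℬ(Π_{X̲_K})⁰` attached to an isomorphism `f : G ⥲ H`
of isomorphs, relative to the markings. ([IUTchI] Def 6.1 (vi) p.159) [claim: Mochizuki2012, status: disputed] -/
def toModelAut {G H : D.Glob} (f : G ≅ H) : Aut (D.gModelObj) :=
  (D.IsGlobIsomorph).ι.mapIso ((D.gMarking G).symm ≪≫ f ≪≫ D.gMarking H)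

/-- The underlying morphism of `toModelAut f` is that of `μ_G⁻¹ ≫ f ≫ μ_H`. ([IUTchI] Def 6.1 (vi) p.159) [claim: Mochizuki2012, status: disputed] -/
theorem toModelAut_hom {G H : D.Glob} (f : G ≅ H) :
    (D.toModelAut f).hom = (((D.gMarking G).symm ≪≫ f ≪≫ D.gMarking H).hom).hom := rfl

/-- `toModelAut (𝟙) = 1`. ([IUTchI] Def 6.1 (vi) p.159) [claim: Mochizuki2012, status: disputed] -/
theorem toModelAut_refl (G : D.Glob) : D.toModelAut (Iso.refl G) = 1 := by
  change (D.IsGlobIsomorph).ι.mapIso _ = Iso.refl ((D.IsGlobIsomorph).ι.obj D.gModel)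
  rw [Iso.refl_trans, Iso.symm_self_id, Functor.mapIso_refl]

/-- `toModelAut (f ≫ g) = toModelAut g * toModelAut f` (composition in `Aut` is reversed; the markings of the middle object cancel).
([IUTchI] Def 6.1 (vi) p.159) [claim: Mochizuki2012, status: disputed] -/
theorem toModelAut_trans {G H J : D.Glob} (f : G ≅ H) (g : H ≅ J) :
    D.toModelAut (f ≪≫ g) = D.toModelAut g * D.toModelAut f := by
  change (D.IsGlobIsomorph).ι.mapIso _ = (D.IsGlobIsomorph).ι.mapIso _ ≪≫ (D.IsGlobIsomorph).ι.mapIso _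
  rw [← Functor.mapIso_trans]
  congr 1
  simp only [Iso.trans_assoc, Iso.self_symm_id_assoc]

/-- At the model, on an automorphism given by an ambient automorphism `α` of `𝒟^{⊚±}`: `toModelAut (isoMk α) = α`.
([IUTchI] Def 6.1 (vi) p.159) [claim: Mochizuki2012, status: disputed] -/
theorem toModelAut_isoMk (α : Aut (D.gModelObj)) :
    D.toModelAut ((D.IsGlobIsomorph).isoMk α : D.gModel ≅ D.gModel) = α := by
  apply Aut.ext
  rw [toModelAut_hom, gMarking_gModel]
  simp

/-- **`Aut(†𝒟^{⊚±}) → Aut(𝒟^{⊚±})`, `α ↦ μ⁻¹ α μ`, as a group homomorphism** (conjugation by the marking).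
([IUTchI] Def 6.1 (vi) p.159) [claim: Mochizuki2012, status: disputed] -/
def toModelAutHom (G : D.Glob) : Aut G →* Aut (D.gModelObj) where
  toFun := D.toModelAut
  map_one' := D.toModelAut_refl G
  map_mul' α β := D.toModelAut_trans β α

/-- `toModelAutHom G α = toModelAut α`. ([IUTchI] Def 6.1 (vi) p.159) [claim: Mochizuki2012, status: disputed] -/
@[simp] theorem toModelAutHom_apply (G : D.Glob) (α : Aut G) : D.toModelAutHom G α = D.toModelAut α := rfl

/-- The automorphism of the isomorph `G` whose reduction is a given automorphism `α` of the model: `μ_G ≫ α ≫ μ_G⁻¹`.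
([IUTchI] Def 6.1 (vi) p.159) [claim: Mochizuki2012, status: disputed] -/
def ofModelAut (G : D.Glob) (α : Aut (D.gModelObj)) : Aut G :=
  D.gMarking G ≪≫ ((D.IsGlobIsomorph).isoMk α : D.gModel ≅ D.gModel) ≪≫ (D.gMarking G).symm

/-- `toModelAut (ofModelAut G α) = α` — every automorphism of the model is the reduction of one of `G`.
([IUTchI] Def 6.1 (vi) p.159) [claim: Mochizuki2012, status: disputed] -/
theorem toModelAut_ofModelAut (G : D.Glob) (α : Aut (D.gModelObj)) : D.toModelAut (D.ofModelAut G α) = α := by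
  apply Aut.ext
  rw [toModelAut_hom, ofModelAut]
  simp

/-- `toModelAutHom G` is surjective. ([IUTchI] Def 6.1 (vi) p.159) [claim: Mochizuki2012, status: disputed] -/
theorem toModelAutHom_surjective (G : D.Glob) : Function.Surjective (D.toModelAutHom G) :=
  fun α => ⟨D.ofModelAut G α, D.toModelAut_ofModelAut G α⟩

/-- `toModelAutHom G` is injective (the inclusion of the full subcategory is faithful and markings are isomorphisms).
([IUTchI] Def 6.1 (vi) p.159) [claim: Mochizuki2012, status: disputed] -/
theorem toModelAutHom_injective (G : D.Glob) : Function.Injective (D.toModelAutHom G) := by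
  intro α β h
  have hA : (D.gMarking G).symm ≪≫ α ≪≫ D.gMarking G = (D.gMarking G).symm ≪≫ β ≪≫ D.gMarking G :=
    Iso.ext ((D.IsGlobIsomorph).ι.map_injective (congrArg Iso.hom h))
  have h3 : @Eq (G ≅ G) α β := by
    have h4 := congrArg (fun e => D.gMarking G ≪≫ e ≪≫ (D.gMarking G).symm) hA
    simpa only [Iso.trans_assoc, Iso.self_symm_id, Iso.trans_refl, Iso.self_symm_id_assoc] using h4
  exact h3

/-- `Aut(†𝒟^{⊚±}) ≅ Aut(𝒟^{⊚±})` (bijectivity of the conjugation by the marking). ([IUTchI] Def 6.1 (vi) p.159) [claim: Mochizuki2012, status: disputed] -/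
theorem toModelAutHom_bijective (G : D.Glob) : Function.Bijective (D.toModelAutHom G) :=
  ⟨D.toModelAutHom_injective G, D.toModelAutHom_surjective G⟩

/-! ### Kit slots `GLab`, `gLabMap` on all of `Glob` -/

/-- **Kit slot `GLab`**: `LabCusp^±(†𝒟^{⊚±})` «may be identified with the set of cusps of `†𝒟^{⊚±}`» (Def 6.1 (vi)) — in the
Π-avatar every isomorph carries the cusp set `Cusp(X̲_K)` of the model, the identification with its own cusps being the marking.
([IUTchI] Def 6.1 (vi) p.159) [claim: Mochizuki2012, status: disputed] -/
abbrev GLabOf (_G : D.Glob) : Type w := D.geom.pe.Cusp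

variable (CG : D.geom.pe.CuspGalois) (hS : D.CuspClassesNormaliserStable)

/-- **Kit slot `gLabMap`**: the bijection of label sets induced by an isomorphism `f : †𝒟^{⊚±} ⥲ ‡𝒟^{⊚±}` — the label action
(`gLabAutModel`, `PiAvatarGlobalLabelAction`) of the automorphism `μ⁻¹ f μ'` of the model. ([IUTchI] Def 6.1 (vi) p.159) [claim: Mochizuki2012, status: disputed] -/
def gLabIso {G H : D.Glob} (f : G ≅ H) : D.GLabOf G ≃ D.GLabOf H :=
  D.gLabAutModel CG hS (D.toModelAut f)

/-- Kit law `gLabMap_refl`. ([IUTchI] Def 6.1 (vi) p.159) [claim: Mochizuki2012, status: disputed] -/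
theorem gLabIso_refl (G : D.Glob) : D.gLabIso CG hS (Iso.refl G) = Equiv.refl _ := by
  rw [gLabIso, toModelAut_refl, map_one]
  rfl

/-- Kit law `gLabMap_trans`. ([IUTchI] Def 6.1 (vi) p.159) [claim: Mochizuki2012, status: disputed] -/
theorem gLabIso_trans {G H J : D.Glob} (f : G ≅ H) (g : H ≅ J) :
    D.gLabIso CG hS (f ≪≫ g) = (D.gLabIso CG hS f).trans (D.gLabIso CG hS g) := by
  rw [gLabIso, gLabIso, gLabIso, toModelAut_trans, map_mul, Equiv.Perm.mul_def]

/-- On automorphisms, `gLabIso` is the homomorphism `gLabAutModel ∘ toModelAutHom G`. ([IUTchI] Def 6.1 (vi) p.159) [claim: Mochizuki2012, status: disputed] -/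
theorem gLabIso_eq_comp_apply (G : D.Glob) (α : Aut G) :
    D.gLabIso CG hS α = (D.gLabAutModel CG hS).comp (D.toModelAutHom G) α := rfl

/-- At the model, on `isoMk α`: `gLabIso (isoMk α) = gLabAutModel α`. ([IUTchI] Def 6.1 (vi) p.159) [claim: Mochizuki2012, status: disputed] -/
theorem gLabIso_isoMk (α : Aut (D.gModelObj)) :
    D.gLabIso CG hS ((D.IsGlobIsomorph).isoMk α : D.gModel ≅ D.gModel) = D.gLabAutModel CG hS α := by
  rw [gLabIso, toModelAut_isoMk]

/-! ### Kit slot `toFlStar` on all of `Glob`; kit laws `autCsp_le`, `gLab_range`, `toFlStar_surjective` -/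

variable [Fact l.Prime] [(D.PiXund.subgroupOf D.PiXK).Normal]

/-- **Kit slot `toFlStar G : Aut(†𝒟^{⊚±}) →* 𝔽_l^⋇`** («which may be reconstructed category-theoretically from `𝒟^{⊚±}`», hence
transported to every isomorph): `toFlStarGlobal ∘ (α ↦ μ⁻¹ α μ)`; independent of the marking because `𝔽_l^⋇` is abelian and
`Aut(†𝒟^{⊚±})`-conjugation does not change the value. ([IUTchI] Def 6.1 (v) p.158) [claim: Mochizuki2012, status: disputed] -/
def toFlStarOf (G : D.Glob) : Aut G →* FlStar l := (D.toFlStarGlobal).comp (D.toModelAutHom G)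

/-- `toFlStarOf G α = toFlStarGlobal (toModelAut α)`. ([IUTchI] Def 6.1 (v) p.158) [claim: Mochizuki2012, status: disputed] -/
theorem toFlStarOf_apply (G : D.Glob) (α : Aut G) : D.toFlStarOf G α = D.toFlStarGlobal (D.toModelAut α) := rfl

/-- At the model: `toFlStarOf gModel (isoMk α) = toFlStarGlobal α`. ([IUTchI] Def 6.1 (v) p.158) [claim: Mochizuki2012, status: disputed] -/
theorem toFlStarOf_gModel_isoMk (α : Aut (D.gModelObj)) :
    D.toFlStarOf D.gModel ((D.IsGlobIsomorph).isoMk α : D.gModel ≅ D.gModel) = D.toFlStarGlobal α := by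
  rw [toFlStarOf_apply, toModelAut_isoMk]

/-- **Kit law `autCsp_le` on EVERY isomorph** (`∀ G, ∀ α : Aut G, gLabMap α = Equiv.refl _ → toFlStar G α = 1`): an automorphism
fixing all label classes of cusps lies in `Aut_±` («`Aut_csp(†𝒟^{⊚±}) ⊆ Aut_±(†𝒟^{⊚±})`»). ([IUTchI] Def 6.1 (v) p.158) [claim: Mochizuki2012, status: disputed] -/
theorem autCsp_le_of (G : D.Glob) (α : Aut G) (hα : D.gLabIso CG hS α = Equiv.refl _) : D.toFlStarOf G α = 1 :=
  D.toFlStarGlobal_eq_one_of_gLabAutModel_eq_one CG hS hα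

/-- **Kit law `gLab_range` in the literal shape of `PMBaseKit`** (automorphisms of the model OBJECT OF `Glob`): the image of
`Aut_±(𝒟^{⊚±})` in the permutations of `LabCusp^±(𝒟^{⊚±})` is `Aut_±` of its `𝔽_l^±`-torsor structure.
([IUTchI] Def 6.1 (v) p.158) [claim: Mochizuki2012, status: disputed] -/
theorem gLab_range_of (σ : Equiv.Perm D.geom.pe.Cusp) :
    σ ∈ (D.gLabTModel CG).autPM ↔ ∃ α : Aut D.gModel, D.toFlStarOf D.gModel α = 1 ∧ D.gLabIso CG hS α = σ := by
  rw [D.gLab_range_model CG hS σ]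
  constructor
  · rintro ⟨α, hα, rfl⟩
    exact ⟨(D.IsGlobIsomorph).isoMk α, by rw [toFlStarOf_gModel_isoMk, hα], D.gLabIso_isoMk CG hS α⟩
  · rintro ⟨α, hα, rfl⟩
    exact ⟨D.toModelAut α, hα, rfl⟩

omit CG hS in
/-- **Kit law `toFlStar_surjective` on every isomorph, from surjectivity at the model** (the latter = abc-iut-L5-t8's
`toFlStarGlobal_surjective_of_torsionMonodromy`, [IUTchI] Def 6.1 (v) «natural surjective homomorphism `Aut(𝒟^{⊚±}) ↠ 𝔽_l^⋇`»).
([IUTchI] Def 6.1 (v) p.158) [claim: Mochizuki2012, status: disputed] -/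
theorem toFlStarOf_surjective_of (h : Function.Surjective D.toFlStarGlobal) (G : D.Glob) :
    Function.Surjective (D.toFlStarOf G) :=
  h.comp (D.toModelAutHom_surjective G)

/-- `Aut_±(†𝒟^{⊚±})`, i.e. `ker (toFlStarOf G)`, is the preimage of `Aut_±` of the model's label torsor under `gLabIso` (all `G`).
([IUTchI] Def 6.1 (v) p.158) [claim: Mochizuki2012, status: disputed] -/
theorem toFlStarOf_eq_one_iff (G : D.Glob) (α : Aut G) :
    D.toFlStarOf G α = 1 ↔ (D.gLabIso CG hS α : Equiv.Perm D.geom.pe.Cusp) ∈ (D.gLabTModel CG).autPM := by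
  rw [toFlStarOf_apply, ← D.gLabAutModel_mem_autPM_iff CG hS]
  rfl

end InitialThetaData

end GlobTransport

end Literature.IUT.HodgeTheaters
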